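import Summits.BirchSwinnertonDyer.BirchSwinnertonDyer.Theorems.KatoDescentTamePotSupersingularCartanMuRoadDoorsTprimeFive
import Literature.NumberTheory.EllipticCurves.FineSelmerNonsplitCartanFiveLayerZeroDoor
import HarnessLib

/-!
# Route `KatoDescentTamePotSupersingular` (rung K8, sub-rung B4 (t′), cell `bsd-potss`): U₀ DOOR at the `5Nn` rows FROM THE LAYER-0 ISOTYPIC INPUT
# `Hom_{Γ_ℚ}(Cl(𝓞_{ℚ(E[5])}), E[5]) = 0` ALONE (door L6 with (c1), (c3*) automatic)

Seat `bsd-potss-k8t-c4` g26; `--supports stmt-BirchSwinnertonDyer-19982 --as helper`. THEOREMS ONLY (no definition, no named fact, no `sorry`);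
nothing booked; (A), Conjecture A and BSD are proved for NO curve here; items 19202 / 19982 stay OPEN at class level (open inputs class-wide: zeta
crux 24439, lower half of 19984).

`missingUpperBoundAt_five_tame_of_nonsplitCartanBasis_of_homTrivial_layerZero` — U₀ `MissingUpperBoundAt E 5` at a rank-`0` (t′) row with mod-`5`
image `C_ns⁺(5)`, modulo `hKatoA hGZK hmod`, from the basis data (`e hε he σx hσx`) and ONE displayed input: (c2*)₀ «every additive `Γ_ℚ`-equivariant
map `Cl(𝓞_{ℚ(E[5])}) → E[5]` is zero» (the `E[5]`-isotypic component of `Cl(ℚ(E[5]))/5` vanishes).  WEAKER than the rank-equality input `hrank` of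
`…_of_rankEq'` (which kills every odd constituent of `Cl(ℚ(E[5]))/5`): meant for the 12 KT `5Nn` rows where `rank_5 Cl(ℚ(P)) > rank_5 Cl(ℚ(x(P)))`
(kit j333672) whenever the extra classes live in a twist of `E[5]` rather than in `E[5]` itself (kit j334168 / j334241).  Literature road:
`CoatesSujatha2005.RankEqualityRoad.conjA_five_of_nonsplitCartanBasis_of_homTrivial_layerZero` (k8t-c4 g26: door L6 in inertia form, (c3*-I) by
`pow_twelve_mem_inertia_of_nonsplitCartanNormalizer`, (c1) automatic) ∘ `CartanMuRoadDoorsTprimeFive.missingUpperBoundAt_tame_of_conjA`.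
CONDITIONAL; per row; nothing booked; BSD for no curve.

References: [Kato2004Asterisque] Thm. 14.5 (3); [CoatesSujatha2005] Thm. 3.4; [DeoRaySujatha2023] Thm. 3.8; [Washington1997] §13; [Serre1972] §2.2, §5.2 (iii).
-/

set_option autoImplicit false
-- the Theorems directory repeats the summit name (`Summits/BirchSwinnertonDyer/BirchSwinnertonDyer/…`): house rule of the cell
set_option linter.dupNamespace false

noncomputable section

open scoped Classical NumberField Matrix
open WeierstrassCurve Field IntermediateField
  Literature.NumberTheory.EllipticCurves Literature.NumberTheory.EllipticCurves.Rank1Residual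
  Literature.NumberTheory.EllipticCurves.Rank1Residual.Typed
  Literature.NumberTheory.GaloisRepresentations Literature.NumberTheory.SerreUniformity
  Literature.NumberTheory.IwasawaTheory Literature.NumberTheory.NumberFields
  Literature.NumberTheory.EllipticCurves.CoatesSujatha2005.RankEqualityRoad
  Summit.BirchSwinnertonDyer.Rank1Residual Summit.BirchSwinnertonDyer.Rank1Residual.Additive
  Summit.BirchSwinnertonDyer.BirchSwinnertonDyer.Theorems

namespace Summit.BirchSwinnertonDyer.BirchSwinnertonDyer.Theorems.TameRankEqRecords

/-- **U₀ `MissingUpperBoundAt E 5` at a rank-`0` (t′) row with image in `C_ns⁺(5)` FROM THE LAYER-0 ISOTYPIC INPUT ALONE** — the named facts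
`hKatoA hGZK hmod`, Cremona's `r_an = 0`, `Addv E 5`, `SubTprime E 5`, `E[5]` irreducible, the basis data (`e hε he σx hσx`, displayed) and the ONE
displayed input `h0` : every additive `Γ_ℚ`-equivariant `Cl(𝓞_{ℚ(E[5])}) → E[5]` vanishes.  NO `μ`-hypothesis, NO inertia / decomposition hypothesis,
no class-number equality.  `conjA_five_of_nonsplitCartanBasis_of_homTrivial_layerZero` ∘ `CartanMuRoadDoorsTprimeFive.missingUpperBoundAt_tame_of_conjA`.
CONDITIONAL; nothing booked; BSD for no curve. [cite: Kato2004Asterisque, Thm. 14.5 (3) (p. 236)] [cite: CoatesSujatha2005, §3 Thm. 3.4]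
[cite: DeoRaySujatha2023, §3 Thm. 3.8 (arXiv:2202.09937 p. 9)] [cite: Serre1972, §2.2 and §5.2 (iii)] -/
theorem missingUpperBoundAt_five_tame_of_nonsplitCartanBasis_of_homTrivial_layerZero (W : WeierstrassCurve ℚ) [W.IsElliptic] [W.IsGloballyMinimal]
    (hKatoA : Kato2004.rankZero_padicValNat_sha_add_padicValNat_tamagawa_le_of_additive_potGood_of_irreducible_of_fineSelmerDual_fg)
    (hGZK : rank_eq_analyticRank_of_analyticRank_le_one) (hmod : hasEntireLFunction_rat)
    (hr : W.analyticRank = 0) (hadd : haveI : Fact (Nat.Prime 5) := ⟨by norm_num⟩; Addv W 5)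
    (hT : haveI : Fact (Nat.Prime 5) := ⟨by norm_num⟩; SubTprime W 5)
    (hirr : haveI : Fact (Nat.Prime 5) := ⟨by norm_num⟩; W.HasIrreducibleModPGaloisRep 5)
    (e : W.geomTorsion (5 : ℕ) ≃+ (Fin 2 → ZMod 5)) {ε : ZMod 5} (hε : ¬ IsSquare ε)
    (he : ∀ σ : absoluteGaloisGroup ℚ, ∃ M ∈ nonsplitCartanNormalizer ε, ∀ P : W.geomTorsion (5 : ℕ), e (σ • P) = M *ᵥ e P)
    (σx : absoluteGaloisGroup ℚ) (hσx : ∀ P : W.geomTorsion (5 : ℕ), e (σx • P) = !![1, ε * (4 - ε); 4 - ε, 1] *ᵥ e P)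
    (h0 : ∀ μ : Additive (ClassGroup (𝓞 ↥(W.divisionField 5))) →+ W.geomTorsion (5 : ℕ),
      (∀ (τ : absoluteGaloisGroup ℚ) (c : ClassGroup (𝓞 ↥(W.divisionField 5))),
        μ (Additive.ofMul (ClassGroup.mulEquiv
          (AmbiguousClass.intAut (absRestrictNormalHom (W.divisionField 5) τ)) c)) = τ • μ (Additive.ofMul c)) → μ = 0) :
    haveI : Fact (Nat.Prime 5) := ⟨by norm_num⟩
    MissingUpperBoundAt W 5 := by
  haveI : Fact (Nat.Prime 5) := ⟨by norm_num⟩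
  exact CartanMuRoadDoorsTprimeFive.missingUpperBoundAt_tame_of_conjA W hKatoA hGZK hmod 5 hr (by decide) hadd hT hirr
    (conjA_five_of_nonsplitCartanBasis_of_homTrivial_layerZero W e hε he σx hσx h0)

end Summit.BirchSwinnertonDyer.BirchSwinnertonDyer.Theorems.TameRankEqRecords

end
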